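import Mathlib
import HarnessLib
import Summits.HubbardSuperconductivity.HubbardSuperconductivity.Theorems.KLProgrammeKLRegimeEngineTowerBlockIncrWtKit
import Summits.HubbardSuperconductivity.HubbardSuperconductivity.Theorems.KLProgrammeKLRegimeEngineTowerBlockIncrWtPowAt
import Summits.HubbardSuperconductivity.HubbardSuperconductivity.Theorems.KLProgrammeKLRegimeEngineTowerBlockIncrWtPowAtSubTadpole

/-!
# Route `KLProgramme` — crux K3 ENGINE (stmt-HubbardSuperconductivity-20437 `KLRegimeEngineV17F2`), stub (b) / E1 interface (E2) in-tower route and located risk #17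
# «(C2)-MOMENTS»: THE DEGREE-`Dw` MODEL Hstep IN KIT FORM (`klWtPinnedSumPow` currency) — for the full increment `Δ_k` AND for the tadpole-free increment
# `Δ_k − Δ_Γ 𝒱_{dk}` — the power-`Dw` twins of `klWtPinnedSumAt_klTowerIncr_le_kit` (…EngineTowerBlockIncrWtKit §2)
# (recipe «(E2)-POW3-TRACK» item T5b «kit»; pen g27 (R472) carriers/link GO; cell gate-hubbard-kl, seat hubbard-kl-k3c3-p2 g19)

The doors `klWtPinnedSumPow_klTowerIncr_le` (✓ …TowerBlockIncrWtPowAt) and `klWtPinnedSumPow_klTowerIncr_subTadpole_le` (…PowAtSubTadpole) carry the DOOR guard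
`θ < 1` and the door brackets; exactly as …EngineTowerBlockIncrWtKit does at degree 1, the weight-blind dictionary `towerNumerics_doorBrackets_le_kit` and `normV_le_towerV`
turn them into the KIT step right side under the KIT guard `(eα/κ²)·towerV D (e²(κ+ρ))² N < 1`, `N m := ε^{2m}·B m`, `B 0 = 0`, `D ≥ |Γ|/2`:

* **`klWtPinnedSumPow_klTowerIncr_le_kit (jr Dw)`** — `klWtPinnedSumPow … J′ jr Dw (2(q+1)) Δ_k i w″ ≤ ε^{2q+1}·cr·cc^{2q+1}·(towerFO … + Σ e·Φ^{n−1}·ψ^{q+1}·towerS … + tail)`;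
* **`klWtPinnedSumPow_klTowerIncr_subTadpole_le_kit (jr Dw)`** — the same for `Δ_k − Δ_Γ 𝒱_{dk}` (the binomial part's `m′ > q+2` sum is majorised by the same `towerFO`
  — a `towerFO` variant starting one input degree higher would be sharper; not needed by the carriers).
Compositions of landed theorems; block constants are HYPOTHESES (degree-`Dw` weighted `α`, `cr/cc`, input sizes `B`); nothing asserts (E2), (X).3, any stub, K3 or
superconductivity.  References: BGM 2006 §2.7 (2.71a), §2.8 (2.77), (2.81)–(2.84), §3 (3.2)–(3.8) [cite: BenfattoGiulianiMastropietro2006].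
-/

noncomputable section

namespace Summit.HubbardSuperconductivity.HubbardSuperconductivity.Theorems.EngineV8

set_option linter.dupNamespace false -- summit = problem name (single-conjunct summit), D-0017

open Real Finset Literature.MathematicalPhysics.QuantumLattice Literature.Probability.LatticeModels GrassmannAlgebra
open Summit.HubbardSuperconductivity.HubbardSuperconductivity.Theorems.KLProgrammeLegKernels
open Summit.HubbardSuperconductivity.HubbardSuperconductivity.Theorems.KLRegimeSplit
open Summit.HubbardSuperconductivity.HubbardSuperconductivity.Theorems.KLRegimeWick
open Summit.HubbardSuperconductivity.HubbardSuperconductivity.Theorems.TwoPointAssembly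
open Literature.Probability.LatticeModels.BattleFederbush

section Born

variable {L M : ℕ} [NeZero L] [NeZero M]

/-- **THE DEGREE-`Dw` MODEL Hstep IN KIT FORM, full increment** (`klWtPinnedSumPow` currency): `klWtPinnedSumAt_klTowerIncr_le_kit` with the weight `klScaleWtPow L M β jr Dw`.
[cite: BenfattoGiulianiMastropietro2006, (2.71a), (2.77), (2.81)-(2.84), (3.2)-(3.8)] -/
theorem klWtPinnedSumPow_klTowerIncr_le_kit {β : ℝ} (hβ : 0 < β) (U μ : ℝ) (K : TrigPolyC4v) (jr Dw : ℕ) {d k J' : ℕ} (hd : 1 ≤ d)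
    (hk : 1 ≤ k)
    (hJ' : d * k ≤ J')
    (hZ : hubbardEffPartitionFnCT L M β U μ 0 K (klScale klE0 (d * k)) ≠ 0)
    {κ : ℝ} (hκ : 0 < κ)
    (hGB : IsGramBoundedR ((sectorSubMatrix L M β (bgmFatMultiplier L M klE0 β (nambuXiCT L μ K) (d * k - 1))).transpose *
      hubbardCovSliceCT L M β μ 0 K (klScale klE0 (d * (k + 1))) (klScale klE0 (d * k)) *
        sectorSubMatrix L M β (bgmFatMultiplier L M klE0 β (nambuXiCT L μ K) (d * k - 1))) κ)
    (B : ℕ → ℝ) (hB0 : ∀ m', 0 ≤ B m') (hB00 : B 0 = 0)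
    (hB : ∀ (m' : ℕ) (t : Fin (2 * m')) (w : SpaceTimeIdx L M × SectorLeg (sectorCount (d * k - 1))),
      ∑ Y ∈ univ.filter (fun Y : Fin (2 * m') → SpaceTimeIdx L M × SectorLeg (sectorCount (d * k - 1)) => Y t = w),
        klScaleWtPow L M β jr Dw ((univ.image Y).image (latticeLegPos (2 * (2 * M)))) *
          ‖kernel ℂ (ExteriorAlgebra.map (Matrix.toLin' (sectorAnalysisMatrix L M β (klAnisoFamily L M β μ K klE0 (d * k - 1))))
            (klTowerInput L M β U μ K d k)) (2 * m') Y‖ ≤ B m')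
    {α : ℝ} (hα : 0 < α)
    (hrow : ∀ X, ∑ Y, ‖((sectorSubMatrix L M β (bgmFatMultiplier L M klE0 β (nambuXiCT L μ K) (d * k - 1))).transpose *
        hubbardCovSliceCT L M β μ 0 K (klScale klE0 (d * (k + 1))) (klScale klE0 (d * k)) *
          sectorSubMatrix L M β (bgmFatMultiplier L M klE0 β (nambuXiCT L μ K) (d * k - 1))) X Y‖ *
        klScaleWtPow L M β jr Dw {latticeLegPos (2 * (2 * M)) X, latticeLegPos (2 * (2 * M)) Y} ≤ α)
    (hcol : ∀ Y, ∑ X, ‖((sectorSubMatrix L M β (bgmFatMultiplier L M klE0 β (nambuXiCT L μ K) (d * k - 1))).transpose *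
        hubbardCovSliceCT L M β μ 0 K (klScale klE0 (d * (k + 1))) (klScale klE0 (d * k)) *
          sectorSubMatrix L M β (bgmFatMultiplier L M klE0 β (nambuXiCT L μ K) (d * k - 1))) X Y‖ *
        klScaleWtPow L M β jr Dw {latticeLegPos (2 * (2 * M)) X, latticeLegPos (2 * (2 * M)) Y} ≤ α)
    {ρ : ℝ} (hρ : 0 < ρ) {D : ℕ} (hD : Fintype.card (SpaceTimeIdx L M × SectorLeg (sectorCount (d * k - 1))) / 2 ≤ D)
    (hguard : Real.exp 1 * α / κ ^ 2 *
      towerV D ((Real.exp 2 * (κ + ρ)) ^ 2) (fun m' => imagTimeWeight β M ^ (2 * m') * B m') < 1)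
    {cr cc : ℝ} (hcr0 : 0 ≤ cr) (hcc0 : 0 ≤ cc)
    (hrow' : ∀ X'', ∑ X', ‖(sectorAnalysisMatrix L M β (klAnisoFamily L M β μ K klE0 J') *
        sectorSubMatrix L M β (bgmFatMultiplier L M klE0 β (nambuXiCT L μ K) (d * k - 1))) X'' X'‖ *
        klScaleWtPow L M β jr Dw {latticeLegPos (2 * (2 * M)) X'', latticeLegPos (2 * (2 * M)) X'} ≤ cr)
    (hcol' : ∀ X', ∑ X'', ‖(sectorAnalysisMatrix L M β (klAnisoFamily L M β μ K klE0 J') *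
        sectorSubMatrix L M β (bgmFatMultiplier L M klE0 β (nambuXiCT L μ K) (d * k - 1))) X'' X'‖ *
        klScaleWtPow L M β jr Dw {latticeLegPos (2 * (2 * M)) X'', latticeLegPos (2 * (2 * M)) X'} ≤ cc)
    {N₀ : ℕ} (hN₀ : 2 ≤ N₀) (q : ℕ) (i : Fin (2 * (q + 1))) (w'' : SpaceTimeIdx L M × SectorLeg (sectorCount J')) :
    klWtPinnedSumPow L M β μ K J' jr Dw (2 * (q + 1)) (klTowerIncr L M β U μ K d k) i w'' ≤
      imagTimeWeight β M ^ (2 * q + 1) *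
        (cr * cc ^ (2 * q + 1) *
          (towerFO D (κ ^ 2) (fun m' => imagTimeWeight β M ^ (2 * m') * B m') (q + 1) +
            ∑ n ∈ Icc 2 (N₀ - 1), Real.exp 1 * (Real.exp 1 * α / κ ^ 2) ^ (n - 1) * (ρ⁻¹ ^ 2) ^ (q + 1) *
              towerS D ((Real.exp 2 * (κ + ρ)) ^ 2) (fun m' => imagTimeWeight β M ^ (2 * m') * B m') n (q + 1) +
            (ρ⁻¹ ^ 2) ^ (q + 1) * Real.exp 1 * towerV D ((Real.exp 2 * (κ + ρ)) ^ 2) (fun m' => imagTimeWeight β M ^ (2 * m') * B m') *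
              (Real.exp 1 * α / κ ^ 2 * towerV D ((Real.exp 2 * (κ + ρ)) ^ 2) (fun m' => imagTimeWeight β M ^ (2 * m') * B m')) ^ (N₀ - 1) /
              (1 - Real.exp 1 * α / κ ^ 2 * towerV D ((Real.exp 2 * (κ + ρ)) ^ 2) (fun m' => imagTimeWeight β M ^ (2 * m') * B m')))) := by
  set N : ℕ → ℝ := fun m' => imagTimeWeight β M ^ (2 * m') * B m' with hN
  have hε : 0 ≤ imagTimeWeight β M := imagTimeWeight_nonneg hβ.le M
  have hN0 : ∀ m, 0 ≤ N m := fun m => mul_nonneg (pow_nonneg hε _) (hB0 m)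
  have hN00 : N 0 = 0 := by simp [hN, hB00]
  -- the door guard from the kit guard
  have hnV := normV_le_towerV (Γ := SpaceTimeIdx L M × SectorLeg (sectorCount (d * k - 1))) hκ.le hρ.le hN0 hN00 hD
  have hθ : Real.exp 1 * α * normV (SpaceTimeIdx L M × SectorLeg (sectorCount (d * k - 1))) κ ρ N / κ ^ 2 < 1 := by
    have heq : Real.exp 1 * α * normV (SpaceTimeIdx L M × SectorLeg (sectorCount (d * k - 1))) κ ρ N / κ ^ 2 =
        Real.exp 1 * α / κ ^ 2 * normV (SpaceTimeIdx L M × SectorLeg (sectorCount (d * k - 1))) κ ρ N := by ring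
    rw [heq]
    exact lt_of_le_of_lt (mul_le_mul_of_nonneg_left hnV (by positivity)) hguard
  have hborn := klWtPinnedSumPow_klTowerIncr_le (L := L) (M := M) hβ U μ K jr Dw hd hk hJ' hZ hκ hGB B hB0 hB hα hrow hcol hρ hθ hcc0
    hrow' hcol' hN₀ q i w''
  refine hborn.trans (mul_le_mul_of_nonneg_left ?_ (pow_nonneg hε _))
  exact towerNumerics_doorBrackets_le_kit hκ hρ hα.le hcr0 hcc0 hN0 hN00 hD hN₀ q hguard

/-- **THE DEGREE-`Dw` MODEL Hstep IN KIT FORM, increment WITHOUT its block tadpole** `Δ_k − Δ_Γ 𝒱_{dk}`.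
[cite: BenfattoGiulianiMastropietro2006, (2.71a), (2.77), (2.81)-(2.84), (2.86)-(2.90), (3.2)-(3.8)] -/
theorem klWtPinnedSumPow_klTowerIncr_subTadpole_le_kit {β : ℝ} (hβ : 0 < β) (U μ : ℝ) (K : TrigPolyC4v) (jr Dw : ℕ) {d k J' : ℕ} (hd : 1 ≤ d)
    (hk : 1 ≤ k)
    (hJ' : d * k ≤ J')
    (hZ : hubbardEffPartitionFnCT L M β U μ 0 K (klScale klE0 (d * k)) ≠ 0)
    {κ : ℝ} (hκ : 0 < κ)
    (hGB : IsGramBoundedR ((sectorSubMatrix L M β (bgmFatMultiplier L M klE0 β (nambuXiCT L μ K) (d * k - 1))).transpose *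
      hubbardCovSliceCT L M β μ 0 K (klScale klE0 (d * (k + 1))) (klScale klE0 (d * k)) *
        sectorSubMatrix L M β (bgmFatMultiplier L M klE0 β (nambuXiCT L μ K) (d * k - 1))) κ)
    (B : ℕ → ℝ) (hB0 : ∀ m', 0 ≤ B m') (hB00 : B 0 = 0)
    (hB : ∀ (m' : ℕ) (t : Fin (2 * m')) (w : SpaceTimeIdx L M × SectorLeg (sectorCount (d * k - 1))),
      ∑ Y ∈ univ.filter (fun Y : Fin (2 * m') → SpaceTimeIdx L M × SectorLeg (sectorCount (d * k - 1)) => Y t = w),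
        klScaleWtPow L M β jr Dw ((univ.image Y).image (latticeLegPos (2 * (2 * M)))) *
          ‖kernel ℂ (ExteriorAlgebra.map (Matrix.toLin' (sectorAnalysisMatrix L M β (klAnisoFamily L M β μ K klE0 (d * k - 1))))
            (klTowerInput L M β U μ K d k)) (2 * m') Y‖ ≤ B m')
    {α : ℝ} (hα : 0 < α)
    (hrow : ∀ X, ∑ Y, ‖((sectorSubMatrix L M β (bgmFatMultiplier L M klE0 β (nambuXiCT L μ K) (d * k - 1))).transpose *
        hubbardCovSliceCT L M β μ 0 K (klScale klE0 (d * (k + 1))) (klScale klE0 (d * k)) *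
          sectorSubMatrix L M β (bgmFatMultiplier L M klE0 β (nambuXiCT L μ K) (d * k - 1))) X Y‖ *
        klScaleWtPow L M β jr Dw {latticeLegPos (2 * (2 * M)) X, latticeLegPos (2 * (2 * M)) Y} ≤ α)
    (hcol : ∀ Y, ∑ X, ‖((sectorSubMatrix L M β (bgmFatMultiplier L M klE0 β (nambuXiCT L μ K) (d * k - 1))).transpose *
        hubbardCovSliceCT L M β μ 0 K (klScale klE0 (d * (k + 1))) (klScale klE0 (d * k)) *
          sectorSubMatrix L M β (bgmFatMultiplier L M klE0 β (nambuXiCT L μ K) (d * k - 1))) X Y‖ *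
        klScaleWtPow L M β jr Dw {latticeLegPos (2 * (2 * M)) X, latticeLegPos (2 * (2 * M)) Y} ≤ α)
    {ρ : ℝ} (hρ : 0 < ρ) {D : ℕ} (hD : Fintype.card (SpaceTimeIdx L M × SectorLeg (sectorCount (d * k - 1))) / 2 ≤ D)
    (hguard : Real.exp 1 * α / κ ^ 2 *
      towerV D ((Real.exp 2 * (κ + ρ)) ^ 2) (fun m' => imagTimeWeight β M ^ (2 * m') * B m') < 1)
    {cr cc : ℝ} (hcr0 : 0 ≤ cr) (hcc0 : 0 ≤ cc)
    (hrow' : ∀ X'', ∑ X', ‖(sectorAnalysisMatrix L M β (klAnisoFamily L M β μ K klE0 J') *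
        sectorSubMatrix L M β (bgmFatMultiplier L M klE0 β (nambuXiCT L μ K) (d * k - 1))) X'' X'‖ *
        klScaleWtPow L M β jr Dw {latticeLegPos (2 * (2 * M)) X'', latticeLegPos (2 * (2 * M)) X'} ≤ cr)
    (hcol' : ∀ X', ∑ X'', ‖(sectorAnalysisMatrix L M β (klAnisoFamily L M β μ K klE0 J') *
        sectorSubMatrix L M β (bgmFatMultiplier L M klE0 β (nambuXiCT L μ K) (d * k - 1))) X'' X'‖ *
        klScaleWtPow L M β jr Dw {latticeLegPos (2 * (2 * M)) X'', latticeLegPos (2 * (2 * M)) X'} ≤ cc)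
    {N₀ : ℕ} (hN₀ : 2 ≤ N₀) (q : ℕ) (i : Fin (2 * (q + 1))) (w'' : SpaceTimeIdx L M × SectorLeg (sectorCount J')) :
    klWtPinnedSumPow L M β μ K J' jr Dw (2 * (q + 1))
        (klTowerIncr L M β U μ K d k - grassmannLaplacian ℂ (hubbardCovSliceCT L M β μ 0 K (klScale klE0 (d * (k + 1))) (klScale klE0 (d * k))) (klTowerInput L M β U μ K d k)) i w'' ≤
      imagTimeWeight β M ^ (2 * q + 1) *
        (cr * cc ^ (2 * q + 1) *
          (towerFO D (κ ^ 2) (fun m' => imagTimeWeight β M ^ (2 * m') * B m') (q + 1) +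
            ∑ n ∈ Icc 2 (N₀ - 1), Real.exp 1 * (Real.exp 1 * α / κ ^ 2) ^ (n - 1) * (ρ⁻¹ ^ 2) ^ (q + 1) *
              towerS D ((Real.exp 2 * (κ + ρ)) ^ 2) (fun m' => imagTimeWeight β M ^ (2 * m') * B m') n (q + 1) +
            (ρ⁻¹ ^ 2) ^ (q + 1) * Real.exp 1 * towerV D ((Real.exp 2 * (κ + ρ)) ^ 2) (fun m' => imagTimeWeight β M ^ (2 * m') * B m') *
              (Real.exp 1 * α / κ ^ 2 * towerV D ((Real.exp 2 * (κ + ρ)) ^ 2) (fun m' => imagTimeWeight β M ^ (2 * m') * B m')) ^ (N₀ - 1) /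
              (1 - Real.exp 1 * α / κ ^ 2 * towerV D ((Real.exp 2 * (κ + ρ)) ^ 2) (fun m' => imagTimeWeight β M ^ (2 * m') * B m')))) := by
  set N : ℕ → ℝ := fun m' => imagTimeWeight β M ^ (2 * m') * B m' with hN
  have hε : 0 ≤ imagTimeWeight β M := imagTimeWeight_nonneg hβ.le M
  have hN0 : ∀ m, 0 ≤ N m := fun m => mul_nonneg (pow_nonneg hε _) (hB0 m)
  have hN00 : N 0 = 0 := by simp [hN, hB00]
  -- the door guard from the kit guard
  have hnV := normV_le_towerV (Γ := SpaceTimeIdx L M × SectorLeg (sectorCount (d * k - 1))) hκ.le hρ.le hN0 hN00 hD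
  have hθ : Real.exp 1 * α * normV (SpaceTimeIdx L M × SectorLeg (sectorCount (d * k - 1))) κ ρ N / κ ^ 2 < 1 := by
    have heq : Real.exp 1 * α * normV (SpaceTimeIdx L M × SectorLeg (sectorCount (d * k - 1))) κ ρ N / κ ^ 2 =
        Real.exp 1 * α / κ ^ 2 * normV (SpaceTimeIdx L M × SectorLeg (sectorCount (d * k - 1))) κ ρ N := by ring
    rw [heq]
    exact lt_of_le_of_lt (mul_le_mul_of_nonneg_left hnV (by positivity)) hguard
  have hborn := klWtPinnedSumPow_klTowerIncr_subTadpole_le (L := L) (M := M) hβ U μ K jr Dw hd hk hJ' hZ hκ hGB B hB0 hB hα hrow hcol hρ hθ hcc0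
    hrow' hcol' hN₀ q i w''
  have hkit := towerNumerics_doorBrackets_le_kit hκ hρ hα.le hcr0 hcc0 hN0 hN00 hD hN₀ q hguard
  refine hborn.trans (mul_le_mul_of_nonneg_left (le_trans ?_ hkit) (pow_nonneg hε _))
  -- the binomial sum over `m′ > q + 2` is at most the one over `m′ > q + 1` (nonnegative terms)
  refine add_le_add le_rfl (mul_le_mul_of_nonneg_left (sum_le_sum fun m' _ => ?_) (by positivity))
  have hBm := hB0 m'
  by_cases h1 : q + 1 + 1 < m'
  · rw [if_pos h1, if_pos (by omega)]
  · rw [if_neg h1]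
    split_ifs
    · positivity
    · exact le_rfl

end Born

end Summit.HubbardSuperconductivity.HubbardSuperconductivity.Theorems.EngineV8

end
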